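import Summits.HubbardSuperconductivity.HubbardSuperconductivity.Theorems.AnisotropyChordTransferFibre3Hole2L26a
import Summits.HubbardSuperconductivity.HubbardSuperconductivity.Theorems.AnisotropyChordTransferFibre3Hole2L26b
import Summits.HubbardSuperconductivity.HubbardSuperconductivity.Theorems.AnisotropyChordTransferFibre3Hole2Cover

/-!
# Route `AnisotropyChord` / H0 rotor rung: ★ HOLE₂(.75) AT `L = 26` — `TwoHoleGap 26 (3/4·eps1 26)`

The one-body spectral input of the GM₃ assembly `gm3_of_hole2` (p1 g23) at side length `L = 26`: the Neumann gap of the rate-½ walk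
on the `26 × 26` torus with ANY two vertices deleted is at least `¾ε₁(26)`.  Assembly of the kernel facts `checkRepsQ_26a…`
(`…Hole2L26a…`, 2 part(s), the 104 `D₄`-classes `repList 26` = `0 ≤ y ≤ x ≤ 13`) via `checkRepsQ_append`, the identification of
the parts with `repList 26` (`decide`), and `Hole2.twoHoleGap_of_checkRepsQ_repList` (`…Fibre3Hole2Cover`: `D₄`-coverage for every `L`;
soundness `…Fibre3Hole2Quarter`, p2's PROP BS, p1's reductions).
Prover seat `hubbard-h0-rotor-p3` g3; helper for stmt-HubbardSuperconductivity-19089 (`--supports`, helper class).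
WHAT THIS IS NOT: nothing here proves superconductivity in the Hubbard model (rotor TARGET as worded stays FALSE, g15 verdict); this
discharges, at ONE side length, ONE hypothesis (HOLE₂(.75)) of ONE conditional reduction (rung 19089). Tree imports only; no sorry.
-/

set_option linter.dupNamespace false
set_option autoImplicit false

namespace Summit.HubbardSuperconductivity.HubbardSuperconductivity.Theorems.AnisotropyChord.Transfer.Fibre3

namespace Hole2

/-- the kernel-fact parts list exactly `repList 26`. [folklore] -/
theorem repList_26_eq : repList 26 = reps26a ++ reps26b := by
  decide +kernel

/-- every representative separation of the `26 × 26` torus passes the kernel check. [folklore] -/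
theorem checkRepsQ_repList_26 : checkRepsQ 26 (repList 26) = true := by
  rw [repList_26_eq]
  exact checkRepsQ_append (checkRepsQ_26a) checkRepsQ_26b

/-- ★★★ HOLE₂(.75) AT `L = 26`: `TwoHoleGap 26 (3/4 * eps1 26)`, the spectral hypothesis of `gm3_of_hole2` at `L = 26`. [folklore] -/
theorem twoHoleGap_twentySix : TwoHoleGap 26 (3 / 4 * eps1 26) :=
  twoHoleGap_of_checkRepsQ_repList 26 checkRepsQ_repList_26

end Hole2

end Summit.HubbardSuperconductivity.HubbardSuperconductivity.Theorems.AnisotropyChord.Transfer.Fibre3
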